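import Summits.CriticalPhenomena.Ising3D.TaylorFunctionalZSeriesAB
import Summits.CriticalPhenomena.Ising3D.DerivativeFunctionalTermwise
import Literature.MathematicalPhysics.QuantumFieldTheory.ConformalBootstrap3D.MixedCertificateObligations
import Mathlib.Tactic.Linarith
import Mathlib.Tactic.Positivity
import Mathlib.Tactic.Ring
import HarnessLib

/-!
# Termwise positivity rules for a DERIVATIVE-functional certificate (even and odd sector)
(cell `pub-ising3x`, seat boot-1; gate (g2) skeleton of the M3-γ milestone: the derivative analogue of
`MixedCertificateObligations.evenPositive_ofPoints_of_termwise` / `oddPositive_ofPoints_of_termwise`)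

HONEST FRAMING: lottery ticket; floor = tightest certified 3D Ising CFT bounds; no exact-solution
claim without a proof.

For a crossing functional `α⃗` whose five components are Taylor (derivative) functionals at a diagonal
point `(x,x)`:
* `hasSum_evenForm_of_isTaylorAt` — the even-sector quadratic form on a genuine block `g^{0,0}_{Δ,ℓ}` at ANY
  admissible `(Δ,ℓ)` is the `z`-series sum of the forms on the terms:
  `evenForm(g; a,b) = Σ_{(n,j)} (A_{n,j}/λ_ℓ) evenForm(𝒫_{Δ+n,j}; a,b)`;
* `evenPositive_of_isTaylorAt_of_termwise` — **(E5)-type rule**: head `Σ_{(n,j)∈F} … ≥ 0` + every tail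
  term PSD (three closed-form numbers via `CrossingFunctional.evenForm_nonneg_of_det` and (g0′)
  `taylorCoeffAt_crossF_zMono`) ⇒ `EvenPositive α Δσ Δε Δ ℓ`;
* `hasSum_oddForm_of_isTaylorAt` / `oddPositive_of_isTaylorAt_of_termwise` — the odd sector with the
  SIGNED `⟨σεσε⟩` coefficients `A_{n,j}(-t/2,t/2)` (`t = Δσ-Δε`) and the non-negative `⟨εσσε⟩` ones
  (regular points strictly above the bound, `Δ ≠ 1` if `ℓ = 0` — as in the tree's point version).
What a γ-certificate then supplies per `(Δ, ℓ)`-cell is exactly what a β-certificate supplies: finitely many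
head inequalities and a region inequality for the tail terms — now for derivative functionals.
Sources: Kos–Poland–Simmons-Duffin 2014 §3.3 eq. (3.16); Hogervorst–Rychkov 2013 §3 eq. (3.9).
-/

namespace Summit.CriticalPhenomena.Ising3D

open Finset Set
open Literature.MathematicalPhysics.QuantumFieldTheory.ConformalBootstrap3D

/-! ### Even sector -/

/-- **The even form is the `z`-series sum of the term forms** (derivative functional, any admissible point).
[cite: HogervorstRychkov2013, §3 eq. (3.9)] -/
theorem hasSum_evenForm_of_isTaylorAt {x : ℝ} (hx0 : 0 < x) (hx1 : x < 1) (α : CrossingFunctional)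
    (hα : IsTaylorAt α x x) {Δ : ℝ} {ℓ : ℕ} {g : ℝ → ℝ → ℝ} (hadm : IsAdmissible3D Δ ℓ)
    (hg : IsConformalBlock3D 0 0 Δ ℓ g) (Δσ Δε a b : ℝ) :
    HasSum (fun q : ℕ × ℕ => hrCoeff Δ ℓ q.1 q.2 / legendreLam ℓ *
        α.evenForm Δσ Δε (zMono (Δ + (q.1 : ℝ)) q.2) a b) (α.evenForm Δσ Δε g a b) := by
  obtain ⟨h₁, h₂, -, h₄, h₅⟩ := hα
  have s1 := h₁.hasSum_crossF_hrZTerm hx0 hx1 Δσ (-1) hadm hg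
  have s2 := h₂.hasSum_crossF_hrZTerm hx0 hx1 Δε (-1) hadm hg
  have s4 := h₄.hasSum_crossF_hrZTerm hx0 hx1 ((Δσ + Δε) / 2) (-1) hadm hg
  have s5 := h₅.hasSum_crossF_hrZTerm hx0 hx1 ((Δσ + Δε) / 2) 1 hadm hg
  have hs := ((s1.mul_left (a ^ 2)).add (s2.mul_left (b ^ 2))).add ((s4.add s5).mul_left (a * b))
  unfold CrossingFunctional.evenForm
  refine hs.congr_fun fun q => ?_
  ring

/-- **Even-sector positivity from termwise PSD** (finite head `F` + PSD tail terms), at every admissible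
`(Δ, ℓ)` — conserved currents and accidental degeneracies included. [cite: HogervorstRychkov2013, §3 eq. (3.9)] -/
theorem evenPositive_of_isTaylorAt_of_termwise {x : ℝ} (hx0 : 0 < x) (hx1 : x < 1)
    (α : CrossingFunctional) (hα : IsTaylorAt α x x) {Δσ Δε Δ : ℝ} {ℓ : ℕ}
    (hadm : IsAdmissible3D Δ ℓ) (F : Finset (ℕ × ℕ))
    (hhead : ∀ a b : ℝ, 0 ≤ ∑ q ∈ F, hrCoeff Δ ℓ q.1 q.2 / legendreLam ℓ *
      α.evenForm Δσ Δε (zMono (Δ + (q.1 : ℝ)) q.2) a b)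
    (htail : ∀ q : ℕ × ℕ, q ∉ F → InDescendantRange ℓ q.1 q.2 →
      ∀ a b : ℝ, 0 ≤ α.evenForm Δσ Δε (zMono (Δ + (q.1 : ℝ)) q.2) a b) :
    α.EvenPositive Δσ Δε Δ ℓ := by
  intro g hg a b
  have hS := hasSum_evenForm_of_isTaylorAt hx0 hx1 α hα hadm hg Δσ Δε a b
  refine (hhead a b).trans (sum_le_hasSum F (fun q hq => ?_) hS)
  by_cases hr : InDescendantRange ℓ q.1 q.2
  · exact mul_nonneg (div_nonneg (hadm.hrCoeff_nonneg _ _) (legendreLam_pos ℓ).le) (htail q hq hr a b)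
  · rw [hrCoeff_eq_zero_of_not_inDescendantRange Δ hr, zero_div, zero_mul]

/-- **Fully termwise form** (`F = ∅`). [cite: HogervorstRychkov2013, §3 eq. (3.9)] -/
theorem evenPositive_of_isTaylorAt_of_forall {x : ℝ} (hx0 : 0 < x) (hx1 : x < 1)
    (α : CrossingFunctional) (hα : IsTaylorAt α x x) {Δσ Δε Δ : ℝ} {ℓ : ℕ}
    (hadm : IsAdmissible3D Δ ℓ)
    (hterm : ∀ q : ℕ × ℕ, InDescendantRange ℓ q.1 q.2 →
      ∀ a b : ℝ, 0 ≤ α.evenForm Δσ Δε (zMono (Δ + (q.1 : ℝ)) q.2) a b) :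
    α.EvenPositive Δσ Δε Δ ℓ :=
  evenPositive_of_isTaylorAt_of_termwise hx0 hx1 α hα hadm ∅ (by simp) (fun q _ hr => hterm q hr)

/-! ### Odd sector -/

/-- The odd-sector TERM VALUE at `(n,j)` of a 5-vector for external dimensions `(Δσ, Δε)`, `t = Δσ-Δε`:
`(-1)^ℓ (A_{n,j}(-t/2,t/2)/λ_ℓ) α³[F^s_-[𝒫]] + (A_{n,j}(t/2,t/2)/λ_ℓ) (α⁴[F^{Δσ}_-[𝒫]] - α⁵[F^{Δσ}_+[𝒫]])`,
`𝒫 = 𝒫_{Δ+n,j}`, `s = (Δσ+Δε)/2`. [cite: KosPolandSimmonsduffin2014, §3.2 eq. (3.13)] -/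
noncomputable def oddTermValue (α : CrossingFunctional) (Δσ Δε Δ : ℝ) (ℓ : ℕ) (q : ℕ × ℕ) : ℝ :=
  (-1 : ℝ) ^ ℓ * (hrCoeffAB (-(Δσ - Δε) / 2) ((Δσ - Δε) / 2) Δ ℓ q.1 q.2 / legendreLam ℓ) *
      α.α₃ (crossF ((Δσ + Δε) / 2) (-1) (zMono (Δ + (q.1 : ℝ)) q.2)) +
    hrCoeffAB ((Δσ - Δε) / 2) ((Δσ - Δε) / 2) Δ ℓ q.1 q.2 / legendreLam ℓ *
      (α.α₄ (crossF Δσ (-1) (zMono (Δ + (q.1 : ℝ)) q.2)) - α.α₅ (crossF Δσ 1 (zMono (Δ + (q.1 : ℝ)) q.2)))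

/-- **The odd form is the `z`-series sum of the term values** (derivative functional; regular point
strictly above the bound, `Δ ≠ 1` if `ℓ = 0`). [cite: DolanOsborn2004, §3 eqs. (3.9)–(3.12)] -/
theorem hasSum_oddForm_of_isTaylorAt {x : ℝ} (hx0 : 0 < x) (hx1 : x < 1) (α : CrossingFunctional)
    (hα : IsTaylorAt α x x) {Δσ Δε Δ : ℝ} {ℓ : ℕ} {g₁ g₂ : ℝ → ℝ → ℝ}
    (hΔ : unitarityBound3D ℓ < Δ) (hreg : ¬ accidentalDegeneracy3D Δ ℓ) (h1 : ℓ = 0 → Δ ≠ 1)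
    (hg₁ : IsConformalBlock3D (Δσ - Δε) (Δσ - Δε) Δ ℓ g₁)
    (hg₂ : IsConformalBlock3D (-(Δσ - Δε)) (Δσ - Δε) Δ ℓ g₂) :
    HasSum (oddTermValue α Δσ Δε Δ ℓ) (α.oddForm Δσ Δε ℓ g₁ g₂) := by
  obtain ⟨-, -, h₃, h₄, h₅⟩ := hα
  have s3 := h₃.hasSum_crossF_hrZTermAB_neg hx0 hx1 ((Δσ + Δε) / 2) (-1) hΔ hreg h1 hg₁ hg₂
  have s4 := h₄.hasSum_crossF_hrZTermAB_self hx0 hx1 Δσ (-1) hΔ hreg (by ring) hg₂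
  have s5 := h₅.hasSum_crossF_hrZTermAB_self hx0 hx1 Δσ 1 hΔ hreg (by ring) hg₂
  have hs := ((s3.mul_left ((-1 : ℝ) ^ ℓ)).add s4).sub s5
  unfold CrossingFunctional.oddForm
  refine hs.congr_fun fun q => ?_
  simp only [oddTermValue]
  ring

/-- **Odd-sector positivity from termwise non-negativity** (finite head `F` + non-negative tail term
values; regular point strictly above the bound, `Δ ≠ 1` if `ℓ = 0`). [cite: KosPolandSimmonsduffin2014, §3.3 eq. (3.16)] -/
theorem oddPositive_of_isTaylorAt_of_termwise {x : ℝ} (hx0 : 0 < x) (hx1 : x < 1)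
    (α : CrossingFunctional) (hα : IsTaylorAt α x x) {Δσ Δε Δ : ℝ} {ℓ : ℕ}
    (hΔ : unitarityBound3D ℓ < Δ) (hreg : ¬ accidentalDegeneracy3D Δ ℓ) (h1 : ℓ = 0 → Δ ≠ 1)
    (F : Finset (ℕ × ℕ)) (hhead : 0 ≤ ∑ q ∈ F, oddTermValue α Δσ Δε Δ ℓ q)
    (htail : ∀ q : ℕ × ℕ, q ∉ F → 0 ≤ oddTermValue α Δσ Δε Δ ℓ q) :
    α.OddPositive Δσ Δε Δ ℓ := by
  intro g₁ g₂ hg₁ hg₂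
  have hS := hasSum_oddForm_of_isTaylorAt hx0 hx1 α hα hΔ hreg h1 hg₁ hg₂
  exact hhead.trans (sum_le_hasSum F (fun q hq => htail q hq) hS)

/-- Outside the descendant range the odd term value vanishes (both coefficient families do), so the tail
hypothesis is only about `j ≤ ℓ + n` (and parity). [folklore] -/
theorem oddTermValue_eq_zero_of_lt (α : CrossingFunctional) (Δσ Δε Δ : ℝ) {ℓ : ℕ} {q : ℕ × ℕ}
    (hq : ℓ + q.1 < q.2) : oddTermValue α Δσ Δε Δ ℓ q = 0 := by
  unfold oddTermValue
  rw [hrCoeffAB_eq_zero_of_lt _ _ _ hq, hrCoeffAB_eq_zero_of_lt _ _ _ hq]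
  ring

/-! ### End to end: a derivative certificate's obligations give `BoxExcluded` -/

/-- **The γ-certificate interface = the β-certificate interface.** The tree's obligation list
`MixedObligations α Q E₀` (identity, (E2)–(E5), (D2)–(D5); generic in `α`) for a DERIVATIVE crossing
functional `α` Taylor at a diagonal point `(x,x)`, on a set `Q` with `Δσ < 1 ∧ Δε > Δσ + 1/2`, gives
`BoxExcluded Q` — by `MixedObligations.isPositiveAt` and `boxExcluded_of_taylorCrossing_of_gap` (T4-A
proved in `DerivativeFunctionalTermwise`). [cite: KosPolandSimmonsduffin2014, §3.3 eq. (3.16)] -/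
theorem boxExcluded_of_mixedObligations_taylor {x : ℝ} (hx0 : 0 < x) (hx1 : x < 1)
    (α : CrossingFunctional) (hα : IsTaylorAt α x x) {Q : Set (ℝ × ℝ)} {E₀ : ℝ}
    (hQ : ∀ p ∈ Q, p.1 < 1 ∧ p.1 + 1 / 2 < p.2) (h : MixedObligations α Q E₀) : BoxExcluded Q :=
  boxExcluded_of_taylorCrossing_of_gap Q hx0 hx1 α hα hQ h.isPositiveAt

end Summit.CriticalPhenomena.Ising3D
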